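import Literature.NumberTheory.Transcendental.KaehlerHodgeTypeComponentFact
import Literature.NumberTheory.Transcendental.KaehlerHodgeTypeProofs
import Literature.NumberTheory.Transcendental.KaehlerHodgeComplexificationProofs
import HarnessLib

/-!
# Harmonic real forms have harmonic `(p,q)`-components, given the Kähler identity (proofs)

Theorems-only companion of `Literature/NumberTheory/Transcendental/KaehlerHodgeTypeComponentFact.lean`:
the corrected named fact `typeComponent_mem_harmonicForms_of_isManifold_complex g o` (Voisin (2002),
§6.1.2, Cor. 6.9, real form: on a Kähler manifold the real and imaginary parts of `(β ⊗ 1)^{p,q}`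
of a real harmonic `β` are harmonic) is **reduced to the single named fact**
`cHodgeLaplacian_eq_two_smul_dolbeaultLaplacian_of_isManifold_complex g o` (the Kähler identity
`Δ_d = 2Δ_∂̄`, Voisin (2002), Thm. 6.7, unproved in the tree), by assembling three results already
in `Literature/`:

* `typeComponent_mem_charmonicForms_of_kaehlerIdentity` (`KaehlerHodgeTypeProofs.lean`): at a
  complex manifold, `Δ_d = 2Δ_∂̄` ⇒ `Δ_d`-harmonic complex forms have `Δ_d`-harmonic
  `(p,q)`-components (`Δ_∂̄` is bihomogeneous — Voisin's Cor. 6.8/6.9 argument);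
* `mem_charmonicForms_iff_re_im_of_contMDiffMetric` (`KaehlerHodgeComplexificationProofs.lean`):
  for a smooth metric, a complex form is in `ℋᵏ_ℂ` iff its real and imaginary parts are in `ℋᵏ`
  (Voisin (2002), Thm. 5.23: the complex Laplacian is the real one tensored with `ℂ`);
* `typeComponent_mem_harmonicForms_of_isManifold_complex_of`
  (`KaehlerHodgeTypeComponentFact.lean`): the real statement from the complex one and the
  complexification fact.

Hence `typeComponent_mem_harmonicForms_of_kaehlerIdentity` below; and, at a complex manifold, the
original (mis-stated, cf. `KaehlerHodgeTypeCounterexample.lean`) `Prop`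
`typeComponent_mem_harmonicForms g o` as well (`typeComponent_mem_harmonicForms_of_kaehlerIdentity'`),
since there the two `Prop`s are definitionally equal. A closed
`typeComponent_mem_harmonicForms_of_isManifold_complex`-discharge is then one line once
`cHodgeLaplacian_eq_two_smul_dolbeaultLaplacian_of_isManifold_complex` is proved.

## References

* C. Voisin, *Hodge Theory and Complex Algebraic Geometry I* (2002), §6.1.2 (Thm. 6.7, Cor. 6.8,
  Cor. 6.9), Thm. 5.23.
* D. Huybrechts, *Complex Geometry* (2005), Prop. 3.1.12 (iii), Prop. 3.2.6, Cor. 3.2.12.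
-/

noncomputable section

open scoped Manifold ContDiff Topology
open Bundle Module

namespace Literature.NumberTheory.Transcendental

variable {E : Type*} [NormedAddCommGroup E] [NormedSpace ℂ E]
  {M : Type*} [TopologicalSpace M] [ChartedSpace E M] {k m : ℕ}
  [FiniteDimensional ℂ E] {n : ℕ} [Fact (finrank ℝ E = n)] [IsManifold 𝓘(ℝ, E) ∞ M]
  (g : ContMDiffRiemannianMetric 𝓘(ℝ, E) ∞ E (fun x : M ↦ TangentSpace 𝓘(ℝ, E) x))
  (o : (x : M) → Orientation ℝ (TangentSpace 𝓘(ℝ, E) x) (Fin n))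

/-- For the smooth metric `g` (installed as `⟨g.toRiemannianMetric⟩`), the complexification fact
`mem_charmonicForms_iff_re_im o` holds (`mem_charmonicForms_iff_re_im_of_contMDiffMetric`, the
`IsContMDiffRiemannianBundle` instance being Mathlib's for a `ContMDiffRiemannianMetric`).
Voisin (2002), Thm. 5.23. [cite: Voisin2002, Thm. 5.23 (§5.3.1)] -/
theorem mem_charmonicForms_iff_re_im_toRiemannianMetric :
    letI : RiemannianBundle (fun x : M ↦ TangentSpace 𝓘(ℝ, E) x) := ⟨g.toRiemannianMetric⟩
    mem_charmonicForms_iff_re_im (k := k) (m := m) o := by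
  letI : RiemannianBundle (fun x : M ↦ TangentSpace 𝓘(ℝ, E) x) := ⟨g.toRiemannianMetric⟩
  exact mem_charmonicForms_iff_re_im_of_contMDiffMetric o

/-- **Cor. 6.9 (real form) from Thm. 6.7.** On a complex manifold with a smooth Kähler metric
`g`, the Kähler identity `Δ_d = 2Δ_∂̄` in degree `k` (the named fact
`cHodgeLaplacian_eq_two_smul_dolbeaultLaplacian_of_isManifold_complex g o`) implies the corrected
fact `typeComponent_mem_harmonicForms_of_isManifold_complex g o`: the real and imaginary parts of
the `(p,q)`-components of the complexification of a real form in `harmonicForms o h` lie in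
`harmonicForms o h`. Assembly of `typeComponent_mem_charmonicForms_of_kaehlerIdentity`,
`mem_charmonicForms_iff_re_im_of_contMDiffMetric` and
`typeComponent_mem_harmonicForms_of_isManifold_complex_of`. Voisin (2002), §6.1.2, Cor. 6.9;
Huybrechts (2005), Cor. 3.2.12. [cite: Voisin2002, §6.1.2 Cor. 6.9] -/
theorem typeComponent_mem_harmonicForms_of_kaehlerIdentity [IsManifold 𝓘(ℂ, E) ω M]
    (hK : cHodgeLaplacian_eq_two_smul_dolbeaultLaplacian_of_isManifold_complex (k := k) (m := m) g o) :
    typeComponent_mem_harmonicForms_of_isManifold_complex (k := k) (m := m) g o :=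
  typeComponent_mem_harmonicForms_of_isManifold_complex_of g o
    (mem_charmonicForms_iff_re_im_toRiemannianMetric g o)
    ((typeComponent_mem_charmonicForms_of_isManifold_complex_iff g o).2
      (typeComponent_mem_charmonicForms_of_kaehlerIdentity g o hK))

/-- The same conclusion for the original `Prop` `typeComponent_mem_harmonicForms g o` of
`KaehlerHodge.lean`, **at a complex manifold** (where it is definitionally the corrected fact;
as a `Prop` family over real atlases it is false, `KaehlerHodgeTypeCounterexample.lean`).
Voisin (2002), §6.1.2, Cor. 6.9. [cite: Voisin2002, §6.1.2 Cor. 6.9] -/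
theorem typeComponent_mem_harmonicForms_of_kaehlerIdentity' [IsManifold 𝓘(ℂ, E) ω M]
    (hK : cHodgeLaplacian_eq_two_smul_dolbeaultLaplacian_of_isManifold_complex (k := k) (m := m) g o) :
    typeComponent_mem_harmonicForms (k := k) (m := m) g o :=
  (typeComponent_mem_harmonicForms_of_isManifold_complex_iff g o).1
    (typeComponent_mem_harmonicForms_of_kaehlerIdentity g o hK)

end Literature.NumberTheory.Transcendental
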